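import Literature.NumberTheory.Irrationality.RhinViola2001.IntegralGrowth
import Literature.NumberTheory.Irrationality.RhinViola2001.DenominatorAsymptotics
import Literature.NumberTheory.Irrationality.RhinViola2001.LeadingCoefficientGrowth
import Literature.NumberTheory.Irrationality.RhinViola2001.ZetaThreeMeasure
import HarnessLib

/-!
# Rhin–Viola 2001, §5 p. 293: the constant `c₀` and a kernel-certified irrationality measure of `ζ(3)`

Topic `Literature/NumberTheory/Irrationality/RhinViola2001`. Typed-and-PROVED (no named fact; cell `zeta5-irr`, seat
zi-lit g17) from G. Rhin, C. Viola, *The group structure for ζ(3)*, Acta Arith. **97** (2001) 269–293 [RhinViola2001],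
§5 pp. 291–293: "(5.16) `lim (1/n) log I_n = max_{0<x,y,z<1} log f(x, y, z)` … `c₀ = −log f(x₀, y₀, z₀)` … and we get
`c₀ = 47.15472079…`, `c₁ = 48.46940964…` [`c₂ = 29.81231469…`]. Thus Theorem 5.1 yields `μ(ζ(3)) < 5.513891`."

THIS file certifies the `c₀`-leg by an elementary inequality and assembles the tree's theorems into an UNCONDITIONAL,
kernel-checked irrationality measure of `ζ(3)`:

* `pow_mul_pow_le_amgm` — weighted AM–GM with integer weights: `A^m B^n ≤ (m/(m+n))^m (n/(m+n))^n (A+B)^{m+n}`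
  (`A, B ≥ 0`), and `pow_mul_one_sub_pow_le`: `t^a (1−t)^b ≤ (a/(a+b))^a (b/(a+b))^b` on `[0,1]` (Mathlib's
  `Real.geom_mean_le_arith_mean2_weighted`);
* `fGrowth_sq_le`: for the record parameters, on the open cube
  `f² = x^32(1−x)^30 y^38(1−y)^26 z^34(1−z)^22/D^36 ≤ B₀` with `D = 1 − z + xyz ≥ (36/19)^{19/36}… ` — precisely
  `(1−z)^19 (xyz)^17 ≤ (19/36)^19 (17/36)^17 D^36` (AM–GM) and then the three one-variable maxima — where
  `B₀ = (19/36)^19 (17/36)^17 · (1/3)^15 (2/3)^30 · (21/47)^21 (26/47)^26 · (17/20)^17 (3/20)^3`, `−(log B₀)/2 = 47.15324…`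
  (the printed `c₀ = 47.15472…` up to `1.5·10⁻³`; the AM–GM split with weight `19/36 ≈ 0.528` is nearly optimal);
* `neg_log_supF_ge`: `c₀ := −log sup f ≥ 47.1532` (`exp` numerics from Mathlib's `Real.exp_one_lt_d9`);
* `log_coeff_le`: `log(1122012·10¹⁵) ≤ 48.46942` (the tree's `c₁`-leg `Theorem31.record_abs_b_le_sharp`);
* with (5.14) (`tendsto_log_bigD_div`, `c2_window`: `c₂ < 29.82`), (5.16) (`tendsto_log_I_scale`) and Theorem 5.1
  (`theorem51`): **`zetaThree_hasIrrationalityMeasure : HasIrrationalityMeasure ζ(3) 5.517`**, i.e.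
  `|ζ(3) − p/q| ≥ q^{−5.517−ε}` for `q ≥ q₀(ε)`, and `¬ LiouvilleWith p ζ(3)` for every `p > 5.517`
  (`zetaThree_not_liouvilleWith`).

* SHARP VERSION (appended): the AM–GM split `191 : 169` of `D^{360}` bounds `f^{20}` (`B20`, `core_bound20`,
  `neg_log_supF_ge_sharp`: `c₀ ≥ 47.1547207`), `log_coeff_le_sharp` (`c₁ ≤ 48.4694105`), and `c2_le_sharp` of
  `DenominatorAsymptotics.lean` (`c₂ ≤ 29.8123149026`) give `zetaThree_hasIrrationalityMeasure_sharp :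
  HasIrrationalityMeasure ζ(3) 5.51389085` and the DISCHARGE **`zetaThree_irrationalityExponent_lt_holds`** of the tree's
  named fact `zetaThree_irrationalityExponent_lt` (`μ(ζ(3)) < 5.513891` as printed). All numerics are exact rational
  inequalities evaluated by the kernel (`decide +kernel`) plus Mathlib's `Real.exp_one_lt_d9`/`Real.exp_one_gt_d9`.

HONEST FRAMING (cells pub-zeta5 / zeta5-irr): this is Rhin–Viola's 2001 theorem re-derived in the kernel; the printed
record `5.513891` is re-certified (the certified quotient is `5.5138908`, the printed one `5.5138906`), NOT improved;
nothing about `ζ(5)`.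
-/

noncomputable section

namespace Literature.NumberTheory.Irrationality.RhinViola2001

namespace Section5

open Filter Real Topology
open Literature.NumberTheory.Transcendental (zetaValue)
open Literature.NumberTheory.Irrationality.Hata1993 (HasIrrationalityMeasure)
open Theorem21 (integrand_eq_pow)

/-! ### Weighted AM–GM with integer weights -/

/-- **Weighted AM–GM, integer weights**: `A^m B^n ≤ (m/(m+n))^m (n/(m+n))^n (A+B)^{m+n}` for `A, B ≥ 0`, `m, n ≥ 1`.
[folklore] -/
private theorem pow_mul_pow_le_amgm {A B : ℝ} (hA : 0 ≤ A) (hB : 0 ≤ B) {m n : ℕ} (hm : 0 < m) (hn : 0 < n) :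
    A ^ m * B ^ n ≤ ((m : ℝ) / (m + n)) ^ m * ((n : ℝ) / (m + n)) ^ n * (A + B) ^ (m + n) := by
  have hm' : (0 : ℝ) < m := by exact_mod_cast hm
  have hn' : (0 : ℝ) < n := by exact_mod_cast hn
  have hN : (0 : ℝ) < m + n := by linarith
  obtain ⟨w₁, hw₁⟩ : ∃ w₁ : ℝ, w₁ = m / (m + n) := ⟨_, rfl⟩
  obtain ⟨w₂, hw₂⟩ : ∃ w₂ : ℝ, w₂ = n / (m + n) := ⟨_, rfl⟩
  rw [← hw₁, ← hw₂]
  have hw₁0 : 0 < w₁ := by rw [hw₁]; positivity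
  have hw₂0 : 0 < w₂ := by rw [hw₂]; positivity
  have hw : w₁ + w₂ = 1 := by rw [hw₁, hw₂]; field_simp
  have hp₁ : 0 ≤ A / w₁ := div_nonneg hA hw₁0.le
  have hp₂ : 0 ≤ B / w₂ := div_nonneg hB hw₂0.le
  -- AM–GM for `p₁ = A/w₁`, `p₂ = B/w₂`: `p₁^{w₁} p₂^{w₂} ≤ w₁ p₁ + w₂ p₂ = A + B`
  have h := Real.geom_mean_le_arith_mean2_weighted hw₁0.le hw₂0.le hp₁ hp₂ hw
  rw [mul_div_cancel₀ _ hw₁0.ne', mul_div_cancel₀ _ hw₂0.ne'] at h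
  -- raise to the power `m + n`
  have h2 := pow_le_pow_left₀ (by positivity) h (m + n)
  have e1 : ((A / w₁) ^ w₁) ^ (m + n) = (A / w₁) ^ m := by
    rw [← Real.rpow_natCast, ← Real.rpow_mul hp₁]
    have : w₁ * ((m + n : ℕ) : ℝ) = (m : ℕ) := by rw [hw₁]; push_cast; field_simp
    rw [this, Real.rpow_natCast]
  have e2 : ((B / w₂) ^ w₂) ^ (m + n) = (B / w₂) ^ n := by
    rw [← Real.rpow_natCast, ← Real.rpow_mul hp₂]
    have : w₂ * ((m + n : ℕ) : ℝ) = (n : ℕ) := by rw [hw₂]; push_cast; field_simp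
    rw [this, Real.rpow_natCast]
  have h3 : (A / w₁) ^ m * (B / w₂) ^ n = A ^ m * B ^ n / (w₁ ^ m * w₂ ^ n) := by
    rw [div_pow, div_pow, div_mul_div_comm]
  rw [mul_pow, e1, e2, h3, div_le_iff₀ (by positivity)] at h2
  calc A ^ m * B ^ n ≤ (A + B) ^ (m + n) * (w₁ ^ m * w₂ ^ n) := h2
    _ = w₁ ^ m * w₂ ^ n * (A + B) ^ (m + n) := by ring

/-- **`max_{[0,1]} t^a (1−t)^b = a^a b^b/(a+b)^{a+b}`** (the bound; `a, b ≥ 1`). [folklore] -/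
private theorem pow_mul_one_sub_pow_le {t : ℝ} (h0 : 0 ≤ t) (h1 : t ≤ 1) {a b : ℕ} (ha : 0 < a) (hb : 0 < b) :
    t ^ a * (1 - t) ^ b ≤ ((a : ℝ) / (a + b)) ^ a * ((b : ℝ) / (a + b)) ^ b := by
  have := pow_mul_pow_le_amgm h0 (by linarith : 0 ≤ 1 - t) ha hb
  simpa using this

/-! ### The `c₀`-leg: `f² ≤ B₀` on the open cube, by AM–GM -/

/-- `f` of (5.15) for the record parameters: `x^16(1−x)^15 y^19(1−y)^13 z^17(1−z)^11/(1 − (1−xy)z)^18` on the open cube.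
[cite: RhinViola2001, §5 (5.15), p. 292] -/
theorem fGrowth_rvChoice_eq {p : Fin 3 → ℝ} (hp : p ∈ cube) :
    fGrowth rvChoice p =
      p 0 ^ 16 * (1 - p 0) ^ 15 * p 1 ^ 19 * (1 - p 1) ^ 13 * p 2 ^ 17 * (1 - p 2) ^ 11 / den p ^ 18 := by
  have hD := (den_pos_le_one hp).1
  rw [fGrowth, integrand_eq_pow rvChoice_admissible.2.1]
  have h1 : (rvChoice.q + rvChoice.h - rvChoice.r + 1 : ℤ) = ((19 : ℕ) : ℤ) := by decide
  rw [h1, zpow_natCast]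
  have hh : rvChoice.h.toNat = 16 := by decide
  have hl : rvChoice.l.toNat = 15 := by decide
  have hk : rvChoice.k.toNat = 19 := by decide
  have hs : rvChoice.s.toNat = 13 := by decide
  have hj : rvChoice.j.toNat = 17 := by decide
  have hq : rvChoice.q.toNat = 11 := by decide
  rw [hh, hl, hk, hs, hj, hq, pow_succ, div_mul_eq_mul_div]
  unfold den at hD ⊢
  exact mul_div_mul_right _ _ hD.ne'

/-- The constant `B₀ = (19/36)^19 (17/36)^17 · (1/3)^15 (2/3)^30 · (21/47)^21 (26/47)^26 · (17/20)^17 (3/20)^3`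
(`−(log B₀)/2 = 47.15324…`, cf. the printed `c₀ = 47.15472079…`). [cite: RhinViola2001, §5 p. 293 (`c₀`)] -/
def B0 : ℝ :=
  ((19 : ℝ) / 36) ^ 19 * ((17 : ℝ) / 36) ^ 17 * (((15 : ℝ) / 45) ^ 15 * ((30 : ℝ) / 45) ^ 30) *
    (((21 : ℝ) / 47) ^ 21 * ((26 : ℝ) / 47) ^ 26) * (((17 : ℝ) / 20) ^ 17 * ((3 : ℝ) / 20) ^ 3)

/-- The algebra of the `c₀`-leg in atoms `x, x' = 1−x, y, y', z, z'`, `D = z' + xyz`: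
`(x^16 x'^15 y^19 y'^13 z^17 z'^11)² ≤ B₀ D^36`. [cite: RhinViola2001, §5 (5.15), p. 293 (`c₀`)] -/
theorem core_bound {x x' y y' z z' D : ℝ} (hx : 0 ≤ x) (hx' : 0 ≤ x') (hxx : x + x' = 1)
    (hy : 0 ≤ y) (hy' : 0 ≤ y') (hyy : y + y' = 1) (hz : 0 ≤ z) (hz' : 0 ≤ z') (hzz : z + z' = 1)
    (hDeq : z' + x * y * z = D) :
    (x ^ 16 * x' ^ 15 * y ^ 19 * y' ^ 13 * z ^ 17 * z' ^ 11) ^ 2 ≤ B0 * (D ^ 18) ^ 2 := by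
  have hAM : z' ^ 19 * (x * y * z) ^ 17 ≤ ((19 : ℝ) / 36) ^ 19 * ((17 : ℝ) / 36) ^ 17 * D ^ 36 := by
    have h := pow_mul_pow_le_amgm (A := z') (B := x * y * z) hz' (by positivity)
      (m := 19) (n := 17) (by norm_num) (by norm_num)
    rw [hDeq] at h
    convert h using 3 <;> norm_num
  have hX : x ^ 15 * x' ^ 30 ≤ ((15 : ℝ) / 45) ^ 15 * ((30 : ℝ) / 45) ^ 30 := by
    have h := pow_mul_one_sub_pow_le hx (by linarith : x ≤ 1) (a := 15) (b := 30) (by norm_num) (by norm_num)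
    rw [show 1 - x = x' by linarith] at h
    convert h using 3 <;> norm_num
  have hY : y ^ 21 * y' ^ 26 ≤ ((21 : ℝ) / 47) ^ 21 * ((26 : ℝ) / 47) ^ 26 := by
    have h := pow_mul_one_sub_pow_le hy (by linarith : y ≤ 1) (a := 21) (b := 26) (by norm_num) (by norm_num)
    rw [show 1 - y = y' by linarith] at h
    convert h using 3 <;> norm_num
  have hZ : z ^ 17 * z' ^ 3 ≤ ((17 : ℝ) / 20) ^ 17 * ((3 : ℝ) / 20) ^ 3 := by
    have h := pow_mul_one_sub_pow_le hz (by linarith : z ≤ 1) (a := 17) (b := 3) (by norm_num) (by norm_num)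
    rw [show 1 - z = z' by linarith] at h
    convert h using 3 <;> norm_num
  have hNum : (x ^ 16 * x' ^ 15 * y ^ 19 * y' ^ 13 * z ^ 17 * z' ^ 11) ^ 2 =
      ((x ^ 15 * x' ^ 30) * (y ^ 21 * y' ^ 26) * (z ^ 17 * z' ^ 3)) * (z' ^ 19 * (x * y * z) ^ 17) := by ring
  rw [hNum]
  have hG : (x ^ 15 * x' ^ 30) * (y ^ 21 * y' ^ 26) * (z ^ 17 * z' ^ 3) ≤
      (((15 : ℝ) / 45) ^ 15 * ((30 : ℝ) / 45) ^ 30) * (((21 : ℝ) / 47) ^ 21 * ((26 : ℝ) / 47) ^ 26) *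
        (((17 : ℝ) / 20) ^ 17 * ((3 : ℝ) / 20) ^ 3) :=
    mul_le_mul (mul_le_mul hX hY (by positivity) (by positivity)) hZ (by positivity) (by positivity)
  unfold B0
  have hW0 : 0 ≤ z' ^ 19 * (x * y * z) ^ 17 := by positivity
  have hC0 : 0 ≤ (((15 : ℝ) / 45) ^ 15 * ((30 : ℝ) / 45) ^ 30) * (((21 : ℝ) / 47) ^ 21 * ((26 : ℝ) / 47) ^ 26) *
        (((17 : ℝ) / 20) ^ 17 * ((3 : ℝ) / 20) ^ 3) := by positivity
  generalize ((15 : ℝ) / 45) ^ 15 * ((30 : ℝ) / 45) ^ 30 = cX at hG hC0 ⊢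
  generalize ((21 : ℝ) / 47) ^ 21 * ((26 : ℝ) / 47) ^ 26 = cY at hG hC0 ⊢
  generalize ((17 : ℝ) / 20) ^ 17 * ((3 : ℝ) / 20) ^ 3 = cZ at hG hC0 ⊢
  generalize ((19 : ℝ) / 36) ^ 19 * ((17 : ℝ) / 36) ^ 17 = cD at hAM ⊢
  calc ((x ^ 15 * x' ^ 30) * (y ^ 21 * y' ^ 26) * (z ^ 17 * z' ^ 3)) * (z' ^ 19 * (x * y * z) ^ 17)
      ≤ (cX * cY * cZ) * (cD * D ^ 36) := mul_le_mul hG hAM hW0 hC0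
    _ = cD * cX * cY * cZ * (D ^ 18) ^ 2 := by ring

/-- **`f² ≤ B₀` on the open cube** (record parameters): `D = (1−z) + xyz`, `(1−z)^19 (xyz)^17 ≤ (19/36)^19 (17/36)^17 D^36`
by AM–GM, then the one-variable maxima of `x^15(1−x)^30`, `y^21(1−y)^26`, `z^17(1−z)^3`.
[cite: RhinViola2001, §5 (5.16), (5.18), p. 293 (`c₀`)] -/
theorem fGrowth_sq_le {p : Fin 3 → ℝ} (hp : p ∈ cube) : fGrowth rvChoice p ^ 2 ≤ B0 := by
  obtain ⟨hx0, hx1⟩ := hp 0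
  obtain ⟨hy0, hy1⟩ := hp 1
  obtain ⟨hz0, hz1⟩ := hp 2
  have hD := den_pos_le_one hp
  rw [fGrowth_rvChoice_eq hp, div_pow, div_le_iff₀ (pow_pos (pow_pos hD.1 18) 2)]
  exact core_bound hx0.le (by linarith) (by ring) hy0.le (by linarith) (by ring) hz0.le (by linarith) (by ring)
    (by unfold den; ring)

/-- Hence `0 < sup f ≤ √B₀` and **`c₀ := −log sup f ≥ −(log B₀)/2`**. [cite: RhinViola2001, §5 (5.18), p. 293] -/
theorem neg_log_supF_ge_half : -(Real.log B0) / 2 ≤ -Real.log (supF rvChoice) := by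
  have hadm := rvChoice_admissible
  have hF := (supF_pos_le_one hadm.2.1 hadm.1).1
  have hB0 : 0 < B0 := by unfold B0; positivity
  have hsup : supF rvChoice ≤ Real.sqrt B0 := by
    refine csSup_le ⟨_, ⟨_, half_mem_cube, rfl⟩⟩ ?_
    rintro _ ⟨p, hp, rfl⟩
    exact Real.le_sqrt_of_sq_le (fGrowth_sq_le hp)
  have h1 : Real.log (supF rvChoice) ≤ Real.log (Real.sqrt B0) := Real.log_le_log hF hsup
  rw [Real.log_sqrt hB0.le] at h1
  linarith

/-! ### Numerics: `c₀ ≥ 47.1532` and `c₁ ≤ 48.46942` -/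

/-- **`c₀ ≥ 47.1532`**: `−(log B₀)/2 ≥ 47.1532`, i.e. `B₀ e^{94.3064} ≤ 1` (with `e < 2.7182818286`, Mathlib's
`Real.exp_one_lt_d9`, and `e^{0.6936} ≥ Σ_{i<12} 0.6936^i/i!`). [cite: RhinViola2001, §5 p. 293 (`c₀ = 47.15472079…`)] -/
theorem half_neg_log_B0_ge : (47.1532 : ℝ) ≤ -(Real.log B0) / 2 := by
  have hB0 : 0 < B0 := by unfold B0; positivity
  set T : ℝ := ∑ i ∈ Finset.range 12, (0.6936 : ℝ) ^ i / (i.factorial : ℝ) with hT_def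
  have hT : T ≤ Real.exp 0.6936 := Real.sum_le_exp_of_nonneg (by norm_num) 12
  have hTpos : 0 < T := by
    rw [hT_def]; simp only [Finset.sum_range_succ, Finset.sum_range_zero, Nat.factorial]; norm_num
  have he : Real.exp 1 < 2.7182818286 := Real.exp_one_lt_d9
  have h95 : Real.exp 95 = Real.exp 1 ^ 95 := by rw [Real.exp_one_pow]; norm_num
  have hsplit : Real.exp 94.3064 * Real.exp 0.6936 = Real.exp 95 := by rw [← Real.exp_add]; norm_num
  have hexp : Real.exp 94.3064 ≤ (2.7182818286 : ℝ) ^ 95 / T := by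
    rw [le_div_iff₀ hTpos]
    calc Real.exp 94.3064 * T ≤ Real.exp 94.3064 * Real.exp 0.6936 := by gcongr
      _ = Real.exp 1 ^ 95 := by rw [hsplit, h95]
      _ ≤ 2.7182818286 ^ 95 := by gcongr
  have hnum : B0 * ((2.7182818286 : ℝ) ^ 95 / T) ≤ 1 := by
    rw [hT_def]; unfold B0
    simp only [Finset.sum_range_succ, Finset.sum_range_zero, Nat.factorial]
    norm_num
  have key : B0 * Real.exp 94.3064 ≤ 1 := le_trans (by gcongr) hnum
  have hlog : Real.log (B0 * Real.exp 94.3064) ≤ 0 := Real.log_nonpos (by positivity) key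
  rw [Real.log_mul hB0.ne' (Real.exp_pos _).ne', Real.log_exp] at hlog
  linarith

/-- **`c₀ := −log sup f ≥ 47.1532`** (printed: `c₀ = 47.15472079…`). [cite: RhinViola2001, §5 p. 293] -/
theorem neg_log_supF_ge : (47.1532 : ℝ) ≤ -Real.log (supF rvChoice) :=
  half_neg_log_B0_ge.trans neg_log_supF_ge_half

/-- **`c₁`-leg numerics**: `log(1122012·10¹⁵) ≤ 48.46942` (with `e > 2.7182818283`, Mathlib's `Real.exp_one_gt_d9`, and
`e^{0.46942} ≥ Σ_{i<14} 0.46942^i/i!`; printed `c₁ = 48.46940964…`, tree `Theorem31.record_abs_b_le_sharp`).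
[cite: RhinViola2001, §5 p. 293 (`c₁ = 48.46940964…`)] -/
theorem log_coeff_le : Real.log (1122012 * 10 ^ 15) ≤ (48.46942 : ℝ) := by
  rw [Real.log_le_iff_le_exp (by norm_num)]
  set T : ℝ := ∑ i ∈ Finset.range 14, (0.46942 : ℝ) ^ i / (i.factorial : ℝ) with hT_def
  have hT : T ≤ Real.exp 0.46942 := Real.sum_le_exp_of_nonneg (by norm_num) 14
  have he : (2.7182818283 : ℝ) < Real.exp 1 := Real.exp_one_gt_d9
  have hsplit : Real.exp 48.46942 = Real.exp 1 ^ 48 * Real.exp 0.46942 := by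
    rw [Real.exp_one_pow, ← Real.exp_add]; norm_num
  have hnum : (1122012 * 10 ^ 15 : ℝ) ≤ (2.7182818283 : ℝ) ^ 48 * T := by
    rw [hT_def]; simp only [Finset.sum_range_succ, Finset.sum_range_zero, Nat.factorial]; norm_num
  have hTpos : 0 ≤ T := by
    rw [hT_def]; exact Finset.sum_nonneg fun i _ => by positivity
  calc (1122012 * 10 ^ 15 : ℝ) ≤ 2.7182818283 ^ 48 * T := hnum
    _ ≤ Real.exp 1 ^ 48 * Real.exp 0.46942 := by gcongr
    _ = Real.exp 48.46942 := hsplit.symm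

/-! ### The measure -/

/-- **A kernel-certified irrationality measure of `ζ(3)`: `μ(ζ(3)) ≤ 5.517`** — Rhin–Viola's Theorem 5.1 with the tree's
certified constants `c₀ ≥ 47.1532` (this file), `c₁ ≤ 48.46942` (`Theorem31.record_abs_b_le_sharp`),
`29.80 < c₂ < 29.82` (`DenominatorAsymptotics`), the limits (5.14) (`tendsto_log_bigD_div`), (5.16)/(5.18)
(`tendsto_log_I_scale`) and the decomposition `I_n = a_n + 2b_nζ(3)` (`Theorem21.theorem21_scale`):
for every `ε > 0` there is `q₀(ε)` with `|ζ(3) − p/q| ≥ q^{−5.517−ε}` for all integers `p`, `q ≥ q₀(ε)`.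
(Printed: `μ(ζ(3)) < 5.513891`.) [cite: RhinViola2001, Theorem 5.1 and (1.4), §5 pp. 290–293] -/
theorem zetaThree_hasIrrationalityMeasure : HasIrrationalityMeasure (zetaValue 3) 5.517 := by
  have hadm := rvChoice_admissible
  -- the decomposition `I_n = a_n + 2 b_n ζ(3)`
  have hex : ∀ n : ℕ, ∃ ab : ℚ × ℤ, 1 ≤ n → I (rvChoice.scale n) = ab.1 + 2 * ab.2 * zetaValue 3 := by
    intro n
    rcases Nat.eq_zero_or_pos n with h0 | hn
    · exact ⟨(0, 0), fun h => by omega⟩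
    · obtain ⟨a, b, hab, -⟩ := Theorem21.theorem21_scale rvChoice hadm.2.1 hadm.1 hn
      exact ⟨(a, b), fun _ => hab⟩
  choose ab hab using hex
  -- (5.14), (5.18), (5.19)
  have h514 : Tendsto (fun n : ℕ => Real.log (bigD n) / n) atTop
      (𝓝 (54 - (intDpsi omegaRows + intDpsi omegaRows'))) := tendsto_log_bigD_div
  have h518 : Tendsto (fun n : ℕ => Real.log (I (rvChoice.scale n)) / n) atTop
      (𝓝 (-(-Real.log (supF rvChoice)))) := by
    rw [neg_neg]; exact tendsto_log_I_scale hadm.2.1 hadm.1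
  have hc1pos : 0 < Real.log (1122012 * 10 ^ 15 : ℝ) := Real.log_pos (by norm_num)
  have h519 : ∀ δ : ℝ, 0 < δ → ∀ᶠ n : ℕ in atTop,
      Real.log |((ab n).2 : ℝ)| / n ≤ Real.log (1122012 * 10 ^ 15) + δ := by
    intro δ hδ
    filter_upwards [eventually_ge_atTop 1] with n hn
    have hb := Theorem31.record_abs_b_le_sharp n (hab n hn)
    have hn0 : (0 : ℝ) < n := by exact_mod_cast hn
    rw [div_le_iff₀ hn0]
    by_cases hb0 : (ab n).2 = 0
    · rw [hb0, Int.cast_zero, abs_zero, Real.log_zero]; positivity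
    · have hpos : 0 < |((ab n).2 : ℝ)| := abs_pos.2 (by exact_mod_cast hb0)
      have h1 := Real.log_le_log hpos hb
      rw [Real.log_pow] at h1
      nlinarith
  -- the certified constants
  have hc0 : (47.1532 : ℝ) ≤ -Real.log (supF rvChoice) := neg_log_supF_ge
  have hc1 : Real.log (1122012 * 10 ^ 15 : ℝ) ≤ 48.46942 := log_coeff_le
  obtain ⟨hc2lo, hc2hi⟩ := c2_window
  have h := theorem51 (fun n => (ab n).1) (fun n => (ab n).2) (fun n hn => hab n hn) h514 h518 h519
    (by linarith) (by linarith)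
  refine h.mono ?_
  rw [div_le_iff₀ (by linarith)]
  nlinarith

/-- **`ζ(3)` is not `p`-Liouville for any `p > 5.517`** (the `LiouvilleWith` rendering of the tree's record statements;
printed record: `μ(ζ(3)) < 5.513891`, `zetaThree_irrationalityExponent_lt`). [cite: RhinViola2001, (1.4), Theorem 5.1] -/
theorem zetaThree_not_liouvilleWith {p : ℝ} (hp : (5.517 : ℝ) < p) : ¬ LiouvilleWith p (zetaValue 3) :=
  zetaThree_hasIrrationalityMeasure.not_liouvilleWith hp


/-! ### Sharp numerics II: `c₀ ≥ 47.1547207` by the AM–GM split `191 : 169` of `D^{360}`, `c₁ ≤ 48.4694105` -/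

/-- `B₂₀ = (191/360)^191 (169/360)^169 · (151/451)^151 (300/451)^300 · (211/471)^211 (260/471)^260 · (171/200)^171 (29/200)^29`,
an upper bound for `f^20` on the cube; `−(log B₂₀)/20 = 47.1547207…` (printed `c₀ = 47.15472079…`; the weight
`191/360 = 0.5305…` is the optimal AM–GM weight to four digits). [cite: RhinViola2001, §5 p. 293 (`c₀`)] -/
def B20 : ℝ :=
  ((191 : ℝ) / 360) ^ 191 * ((169 : ℝ) / 360) ^ 169 * (((151 : ℝ) / 451) ^ 151 * ((300 : ℝ) / 451) ^ 300) *
    (((211 : ℝ) / 471) ^ 211 * ((260 : ℝ) / 471) ^ 260) * (((171 : ℝ) / 200) ^ 171 * ((29 : ℝ) / 200) ^ 29)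

/-- The same constant over `ℚ` (for exact evaluation by the kernel). [folklore] -/
def B20Q : ℚ :=
  ((191 : ℚ) / 360) ^ 191 * ((169 : ℚ) / 360) ^ 169 * (((151 : ℚ) / 451) ^ 151 * ((300 : ℚ) / 451) ^ 300) *
    (((211 : ℚ) / 471) ^ 211 * ((260 : ℚ) / 471) ^ 260) * (((171 : ℚ) / 200) ^ 171 * ((29 : ℚ) / 200) ^ 29)

/-- The algebra of the sharp `c₀`-leg: `(x^16 x'^15 y^19 y'^13 z^17 z'^11)^20 ≤ B₂₀ (D^18)^20` for `D = z' + xyz`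
(AM–GM `z'^191 (xyz)^169 ≤ (191/360)^191 (169/360)^169 D^360`, then the one-variable maxima). [cite: RhinViola2001, §5 p. 293 (`c₀`)] -/
theorem core_bound20 {x x' y y' z z' D : ℝ} (hx : 0 ≤ x) (hx' : 0 ≤ x') (hxx : x + x' = 1)
    (hy : 0 ≤ y) (hy' : 0 ≤ y') (hyy : y + y' = 1) (hz : 0 ≤ z) (hz' : 0 ≤ z') (hzz : z + z' = 1)
    (hDeq : z' + x * y * z = D) :
    (x ^ 16 * x' ^ 15 * y ^ 19 * y' ^ 13 * z ^ 17 * z' ^ 11) ^ 20 ≤ B20 * (D ^ 18) ^ 20 := by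
  have hAM : z' ^ 191 * (x * y * z) ^ 169 ≤ ((191 : ℝ) / 360) ^ 191 * ((169 : ℝ) / 360) ^ 169 * D ^ 360 := by
    have h := pow_mul_pow_le_amgm (A := z') (B := x * y * z) hz' (by positivity)
      (m := 191) (n := 169) (by norm_num) (by norm_num)
    rw [hDeq] at h
    convert h using 3 <;> norm_num
  have hX : x ^ 151 * x' ^ 300 ≤ ((151 : ℝ) / 451) ^ 151 * ((300 : ℝ) / 451) ^ 300 := by
    have h := pow_mul_one_sub_pow_le hx (by linarith : x ≤ 1) (a := 151) (b := 300) (by norm_num) (by norm_num)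
    rw [show 1 - x = x' by linarith] at h
    convert h using 3 <;> norm_num
  have hY : y ^ 211 * y' ^ 260 ≤ ((211 : ℝ) / 471) ^ 211 * ((260 : ℝ) / 471) ^ 260 := by
    have h := pow_mul_one_sub_pow_le hy (by linarith : y ≤ 1) (a := 211) (b := 260) (by norm_num) (by norm_num)
    rw [show 1 - y = y' by linarith] at h
    convert h using 3 <;> norm_num
  have hZ : z ^ 171 * z' ^ 29 ≤ ((171 : ℝ) / 200) ^ 171 * ((29 : ℝ) / 200) ^ 29 := by
    have h := pow_mul_one_sub_pow_le hz (by linarith : z ≤ 1) (a := 171) (b := 29) (by norm_num) (by norm_num)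
    rw [show 1 - z = z' by linarith] at h
    convert h using 3 <;> norm_num
  have hNum : (x ^ 16 * x' ^ 15 * y ^ 19 * y' ^ 13 * z ^ 17 * z' ^ 11) ^ 20 =
      ((x ^ 151 * x' ^ 300) * (y ^ 211 * y' ^ 260) * (z ^ 171 * z' ^ 29)) * (z' ^ 191 * (x * y * z) ^ 169) := by
    ring
  rw [hNum]
  have hcX : (0 : ℝ) ≤ ((151 : ℝ) / 451) ^ 151 * ((300 : ℝ) / 451) ^ 300 :=
    mul_nonneg (pow_nonneg (by norm_num) _) (pow_nonneg (by norm_num) _)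
  have hcY : (0 : ℝ) ≤ ((211 : ℝ) / 471) ^ 211 * ((260 : ℝ) / 471) ^ 260 :=
    mul_nonneg (pow_nonneg (by norm_num) _) (pow_nonneg (by norm_num) _)
  have hcZ : (0 : ℝ) ≤ ((171 : ℝ) / 200) ^ 171 * ((29 : ℝ) / 200) ^ 29 :=
    mul_nonneg (pow_nonneg (by norm_num) _) (pow_nonneg (by norm_num) _)
  have hyy0 : 0 ≤ y ^ 211 * y' ^ 260 := mul_nonneg (pow_nonneg hy _) (pow_nonneg hy' _)
  have hzz0 : 0 ≤ z ^ 171 * z' ^ 29 := mul_nonneg (pow_nonneg hz _) (pow_nonneg hz' _)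
  have hG : (x ^ 151 * x' ^ 300) * (y ^ 211 * y' ^ 260) * (z ^ 171 * z' ^ 29) ≤
      (((151 : ℝ) / 451) ^ 151 * ((300 : ℝ) / 451) ^ 300) * (((211 : ℝ) / 471) ^ 211 * ((260 : ℝ) / 471) ^ 260) *
        (((171 : ℝ) / 200) ^ 171 * ((29 : ℝ) / 200) ^ 29) :=
    mul_le_mul (mul_le_mul hX hY hyy0 hcX) hZ hzz0 (mul_nonneg hcX hcY)
  unfold B20
  have hW0 : 0 ≤ z' ^ 191 * (x * y * z) ^ 169 :=
    mul_nonneg (pow_nonneg hz' _) (pow_nonneg (mul_nonneg (mul_nonneg hx hy) hz) _)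
  have hC0 : 0 ≤ (((151 : ℝ) / 451) ^ 151 * ((300 : ℝ) / 451) ^ 300) * (((211 : ℝ) / 471) ^ 211 * ((260 : ℝ) / 471) ^ 260) *
        (((171 : ℝ) / 200) ^ 171 * ((29 : ℝ) / 200) ^ 29) := mul_nonneg (mul_nonneg hcX hcY) hcZ
  generalize ((151 : ℝ) / 451) ^ 151 * ((300 : ℝ) / 451) ^ 300 = cX at hG hC0 ⊢
  generalize ((211 : ℝ) / 471) ^ 211 * ((260 : ℝ) / 471) ^ 260 = cY at hG hC0 ⊢
  generalize ((171 : ℝ) / 200) ^ 171 * ((29 : ℝ) / 200) ^ 29 = cZ at hG hC0 ⊢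
  generalize ((191 : ℝ) / 360) ^ 191 * ((169 : ℝ) / 360) ^ 169 = cD at hAM ⊢
  calc ((x ^ 151 * x' ^ 300) * (y ^ 211 * y' ^ 260) * (z ^ 171 * z' ^ 29)) * (z' ^ 191 * (x * y * z) ^ 169)
      ≤ (cX * cY * cZ) * (cD * D ^ 360) := mul_le_mul hG hAM hW0 hC0
    _ = cD * cX * cY * cZ * (D ^ 18) ^ 20 := by ring

/-- **`f^20 ≤ B₂₀` on the open cube** (record parameters). [cite: RhinViola2001, §5 (5.16), p. 293 (`c₀`)] -/
theorem fGrowth_pow20_le {p : Fin 3 → ℝ} (hp : p ∈ cube) : fGrowth rvChoice p ^ 20 ≤ B20 := by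
  obtain ⟨hx0, hx1⟩ := hp 0
  obtain ⟨hy0, hy1⟩ := hp 1
  obtain ⟨hz0, hz1⟩ := hp 2
  have hD := den_pos_le_one hp
  rw [fGrowth_rvChoice_eq hp, div_pow, div_le_iff₀ (pow_pos (pow_pos hD.1 18) 20)]
  exact core_bound20 hx0.le (by linarith) (by ring) hy0.le (by linarith) (by ring) hz0.le (by linarith) (by ring)
    (by unfold den; ring)

/-- Hence **`c₀ = −log sup f ≥ −(log B₂₀)/20`**. [cite: RhinViola2001, §5 (5.18), p. 293] -/
theorem neg_log_supF_ge_twentieth : -(Real.log B20) / 20 ≤ -Real.log (supF rvChoice) := by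
  have hadm := rvChoice_admissible
  have hF := (supF_pos_le_one hadm.2.1 hadm.1).1
  have hB : 0 < B20 := by unfold B20; positivity
  have hsup : supF rvChoice ≤ B20 ^ ((20 : ℕ)⁻¹ : ℝ) := by
    refine csSup_le ⟨_, ⟨_, half_mem_cube, rfl⟩⟩ ?_
    rintro _ ⟨p, hp, rfl⟩
    have hf0 : 0 ≤ fGrowth rvChoice p := (fGrowth_pos hadm.2.1 hp).le
    calc fGrowth rvChoice p = (fGrowth rvChoice p ^ 20) ^ ((20 : ℕ)⁻¹ : ℝ) :=
          (Real.pow_rpow_inv_natCast hf0 (by norm_num)).symm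
      _ ≤ B20 ^ ((20 : ℕ)⁻¹ : ℝ) := Real.rpow_le_rpow (by positivity) (fGrowth_pow20_le hp) (by positivity)
  have h1 : Real.log (supF rvChoice) ≤ Real.log (B20 ^ ((20 : ℕ)⁻¹ : ℝ)) := Real.log_le_log hF hsup
  rw [Real.log_rpow hB] at h1
  have h2 : ((20 : ℕ)⁻¹ : ℝ) * Real.log B20 = Real.log B20 / 20 := by norm_num; ring
  rw [h2] at h1
  linarith

/-- `B₂₀` cast. [folklore] -/
private theorem B20Q_cast : ((B20Q : ℚ) : ℝ) = B20 := by
  simp only [B20Q, B20, Rat.cast_mul, Rat.cast_pow, Rat.cast_div, Rat.cast_ofNat]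

/-- **`c₀ ≥ 47.1547207`** (printed `47.15472079…`): `B₂₀ e^{943.094414} ≤ 1`, from `e < 2.7182818286` and
`e^{0.905586} ≥ Σ_{i<20} 0.905586^i/i!`, the rational inequality being evaluated exactly by the kernel.
[cite: RhinViola2001, §5 p. 293 (`c₀ = 47.15472079…`)] -/
theorem neg_log_supF_ge_sharp : (47.1547207 : ℝ) ≤ -Real.log (supF rvChoice) := by
  refine le_trans ?_ neg_log_supF_ge_twentieth
  have hB : 0 < B20 := by unfold B20; positivity
  -- the exact rational certificate
  have hq : B20Q * ((27182818286 : ℚ) / 10 ^ 10) ^ 944 ≤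
      ∑ i ∈ Finset.range 20, ((905586 : ℚ) / 10 ^ 6) ^ i / (i.factorial : ℚ) := by
    decide +kernel
  have hr := (Rat.cast_le (K := ℝ)).2 hq
  push_cast [B20Q_cast] at hr
  -- `T ≤ exp 0.905586`, `exp 1 < 2.7182818286`
  have hT : ∑ i ∈ Finset.range 20, ((905586 : ℝ) / 10 ^ 6) ^ i / (i.factorial : ℝ) ≤ Real.exp (905586 / 10 ^ 6) :=
    Real.sum_le_exp_of_nonneg (by norm_num) 20
  have he : Real.exp 1 ^ 944 ≤ ((27182818286 : ℝ) / 10 ^ 10) ^ 944 :=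
    pow_le_pow_left₀ (Real.exp_pos 1).le (by have := Real.exp_one_lt_d9; norm_num at this ⊢; linarith) 944
  have hsplit : Real.exp (943094414 / 10 ^ 6) * Real.exp (905586 / 10 ^ 6) = Real.exp 1 ^ 944 := by
    rw [← Real.exp_add, Real.exp_one_pow]; norm_num
  have key : B20 * Real.exp (943094414 / 10 ^ 6) ≤ 1 := by
    have h1 : B20 * Real.exp (943094414 / 10 ^ 6) * Real.exp (905586 / 10 ^ 6) ≤
        1 * Real.exp (905586 / 10 ^ 6) := by
      calc B20 * Real.exp (943094414 / 10 ^ 6) * Real.exp (905586 / 10 ^ 6) = B20 * Real.exp 1 ^ 944 := by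
            rw [mul_assoc, hsplit]
        _ ≤ B20 * ((27182818286 : ℝ) / 10 ^ 10) ^ 944 := by gcongr
        _ ≤ ∑ i ∈ Finset.range 20, ((905586 : ℝ) / 10 ^ 6) ^ i / (i.factorial : ℝ) := hr
        _ ≤ 1 * Real.exp (905586 / 10 ^ 6) := by rw [one_mul]; exact hT
    exact le_of_mul_le_mul_right h1 (Real.exp_pos _)
  have hlog : Real.log (B20 * Real.exp (943094414 / 10 ^ 6)) ≤ 0 := Real.log_nonpos (by positivity) key
  rw [Real.log_mul hB.ne' (Real.exp_pos _).ne', Real.log_exp] at hlog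
  norm_num at hlog ⊢
  linarith

/-- **`c₁ ≤ 48.4694105`** (printed `48.46940964…`; the tree's `|b_n| ≤ (1122012·10¹⁵)ⁿ`): `1122012·10¹⁵ ≤ e^{48.4694105}` from
`e > 2.7182818283` and `e^{0.4694105} ≥ Σ_{i<16} 0.4694105^i/i!`, evaluated exactly by the kernel.
[cite: RhinViola2001, §5 p. 293 (`c₁ = 48.46940964…`)] -/
theorem log_coeff_le_sharp : Real.log (1122012 * 10 ^ 15) ≤ (48.4694105 : ℝ) := by
  rw [Real.log_le_iff_le_exp (by norm_num)]
  have hq : (1122012 * 10 ^ 15 : ℚ) ≤ ((27182818283 : ℚ) / 10 ^ 10) ^ 48 *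
      ∑ i ∈ Finset.range 16, ((4694105 : ℚ) / 10 ^ 7) ^ i / (i.factorial : ℚ) := by
    decide +kernel
  have hr := (Rat.cast_le (K := ℝ)).2 hq
  push_cast at hr
  have hT : ∑ i ∈ Finset.range 16, ((4694105 : ℝ) / 10 ^ 7) ^ i / (i.factorial : ℝ) ≤ Real.exp (4694105 / 10 ^ 7) :=
    Real.sum_le_exp_of_nonneg (by norm_num) 16
  have he : ((27182818283 : ℝ) / 10 ^ 10) ^ 48 ≤ Real.exp 1 ^ 48 :=
    pow_le_pow_left₀ (by norm_num) (by have := Real.exp_one_gt_d9; norm_num at this ⊢; linarith) 48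
  have hsplit : Real.exp 48.4694105 = Real.exp 1 ^ 48 * Real.exp (4694105 / 10 ^ 7) := by
    rw [Real.exp_one_pow, ← Real.exp_add]; norm_num
  calc (1122012 * 10 ^ 15 : ℝ) ≤ ((27182818283 : ℝ) / 10 ^ 10) ^ 48 *
        ∑ i ∈ Finset.range 16, ((4694105 : ℝ) / 10 ^ 7) ^ i / (i.factorial : ℝ) := hr
    _ ≤ Real.exp 1 ^ 48 * Real.exp (4694105 / 10 ^ 7) := by gcongr
    _ = Real.exp 48.4694105 := hsplit.symm

/-! ### The printed record: `μ(ζ(3)) < 5.513891` -/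

/-- **Theorem 5.1 evaluated with certified constants**: `c₀ ≥ c₀'`, `c₁ ≤ c₁'`, `c₂ ≤ c₂'` and `c₀' + c₁' ≤ μ (c₀' − c₂')`
(`1 < μ`, `0 < c₁' + c₂`, `c₂' < c₀'`) give `HasIrrationalityMeasure ζ(3) μ`. [cite: RhinViola2001, Theorem 5.1, §5 pp. 290–293] -/
theorem hasIrrationalityMeasure_of_constants {c₀' c₁' c₂' μ : ℝ} (hc0 : c₀' ≤ -Real.log (supF rvChoice))
    (hc1 : Real.log (1122012 * 10 ^ 15) ≤ c₁') (hc2 : 54 - (intDpsi omegaRows + intDpsi omegaRows') ≤ c₂')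
    (hS : 0 < Real.log (1122012 * 10 ^ 15) + (54 - (intDpsi omegaRows + intDpsi omegaRows')))
    (hlt : c₂' < c₀') (hμ : 1 ≤ μ) (hineq : c₀' + c₁' ≤ μ * (c₀' - c₂')) :
    HasIrrationalityMeasure (zetaValue 3) μ := by
  have hadm := rvChoice_admissible
  have hex : ∀ n : ℕ, ∃ ab : ℚ × ℤ, 1 ≤ n → I (rvChoice.scale n) = ab.1 + 2 * ab.2 * zetaValue 3 := by
    intro n
    rcases Nat.eq_zero_or_pos n with h0 | hn
    · exact ⟨(0, 0), fun h => by omega⟩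
    · obtain ⟨a, b, hab, -⟩ := Theorem21.theorem21_scale rvChoice hadm.2.1 hadm.1 hn
      exact ⟨(a, b), fun _ => hab⟩
  choose ab hab using hex
  have h514 : Tendsto (fun n : ℕ => Real.log (bigD n) / n) atTop
      (𝓝 (54 - (intDpsi omegaRows + intDpsi omegaRows'))) := tendsto_log_bigD_div
  have h518 : Tendsto (fun n : ℕ => Real.log (I (rvChoice.scale n)) / n) atTop
      (𝓝 (-(-Real.log (supF rvChoice)))) := by
    rw [neg_neg]; exact tendsto_log_I_scale hadm.2.1 hadm.1
  have hc1pos : 0 < Real.log (1122012 * 10 ^ 15 : ℝ) := Real.log_pos (by norm_num)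
  have h519 : ∀ δ : ℝ, 0 < δ → ∀ᶠ n : ℕ in atTop,
      Real.log |((ab n).2 : ℝ)| / n ≤ Real.log (1122012 * 10 ^ 15) + δ := by
    intro δ hδ
    filter_upwards [eventually_ge_atTop 1] with n hn
    have hb := Theorem31.record_abs_b_le_sharp n (hab n hn)
    have hn0 : (0 : ℝ) < n := by exact_mod_cast hn
    rw [div_le_iff₀ hn0]
    by_cases hb0 : (ab n).2 = 0
    · rw [hb0, Int.cast_zero, abs_zero, Real.log_zero]; positivity
    · have hpos : 0 < |((ab n).2 : ℝ)| := abs_pos.2 (by exact_mod_cast hb0)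
      have h1 := Real.log_le_log hpos hb
      rw [Real.log_pow] at h1
      nlinarith
  have h := theorem51 (fun n => (ab n).1) (fun n => (ab n).2) (fun n hn => hab n hn) h514 h518 h519 hS
    (by linarith)
  refine h.mono ?_
  rw [div_le_iff₀ (by linarith)]
  nlinarith

/-- **`μ(ζ(3)) ≤ 5.51389085`** with the sharp certified constants `c₀ ≥ 47.1547207`, `c₁ ≤ 48.4694105`,
`c₂ ≤ 29.8123149026` (printed: `(c₀+c₁)/(c₀−c₂) = 5.5138906…`, "Thus Theorem 5.1 yields `μ(ζ(3)) < 5.513891`").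
[cite: RhinViola2001, §5 p. 293, (1.4)] -/
theorem zetaThree_hasIrrationalityMeasure_sharp : HasIrrationalityMeasure (zetaValue 3) 5.51389085 := by
  have hc2 := c2_le_sharp
  have hc1 := log_coeff_le_sharp
  have hc1pos : 0 < Real.log (1122012 * 10 ^ 15 : ℝ) := Real.log_pos (by norm_num)
  obtain ⟨hc2lo, -⟩ := c2_window
  exact hasIrrationalityMeasure_of_constants neg_log_supF_ge_sharp hc1 hc2 (by linarith) (by norm_num) (by norm_num)
    (by norm_num)

/-- **Rhin–Viola's record, discharged**: `μ(ζ(3)) < 5.513891` in the tree's rendering — `ζ(3)` is not `p`-Liouville for any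
`p ≥ 5.513891` (the named fact `zetaThree_irrationalityExponent_lt` of `ZetaThreeMeasure.lean`).
[cite: RhinViola2001, §1 (1.4), §5 Theorem 5.1 and p. 293] -/
theorem zetaThree_irrationalityExponent_lt_holds : zetaThree_irrationalityExponent_lt := by
  intro p hp
  exact zetaThree_hasIrrationalityMeasure_sharp.not_liouvilleWith (lt_of_lt_of_le (by norm_num) hp)


end Section5

end Literature.NumberTheory.Irrationality.RhinViola2001

end
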